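import Summits.ValiantsHypothesis.ValiantsHypothesis.Theorems.TwoProducts.RankTwoJacobianTowerCharts

/-!
# Rank-two Jacobian, P4b: Stage C (i) — polynomial-level notions, `S1`, the candidate set `Xc`, axial leads off `Xc`, the EXCEPTIONAL SET `Eset`

`isEdgeDir_iff_tie`, `special_tie`, `special_axis_top`, `S1`, `Xc` (`card_Xc_le`, `tie_mem_Xc`, `axis_mem_Xc`), `wt_lead_factor`, ★ `axialLead_of_not_mem`, `lead_utop`,
`EV`, `Eset` (`mem_Eset`, `card_Eset_le`, `Eset_zero`).

P4 «TowerKernel» port (val-lit-p3 g18, desk #461 (D)/#465 (C); critic of record val-idea-crit-8 g3 CONTENT GO 03:36:15Z, VERDICT #38 «K13 K1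
`rankTwoCompositionLaw` KERNEL ✓») of `section TowerKernel` (l.645–1593) of val-idea-35 g9's crux workfile `Cruxes/TwoProducts/RankTwoJacobian_val_idea_35_g9.lean`
@a021fde990ed (sha16 2c954d16062836ab, 1595 l., 0 sorry) — bodies VERBATIM, namespace `…Cruxes.TwoProducts.ValIdea35g9` → `…Theorems.TwoProducts.RankTwoJacobian`,
split at the Stage seams for the 400-line lint (TowerCharts = charts + Stage A; TowerExceptional = Stage C up to `Eset`; TowerSpecials = Stage C from `Spec`;
TowerInduction = Stages D + B; Tower = Stage E + K1), one-line docstrings added where the workfile had none; over ✓ P1–P3 `…RankTwoJacobian{,Ostrowski,Axial}`.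
HONEST LABEL: K13 K1 = the decided sub-class «affine table rank ≤ 2» of the SIDE ladder «table-rank-ladder» of crux `stmt-ValiantsHypothesis-5906` (`TwoProducts`);
0 distance on `ResidualLawV25`; nothing here closes 5906 / `PlanarCellBound`; VP ≠ VNP is NOT proved.  `--supports stmt-ValiantsHypothesis-5906 --as helper`.
Credit: val-idea-35 g9 (everything).  No instances, no notation, no named facts. [folklore]
-/

noncomputable section
set_option linter.dupNamespace false

namespace Summit.ValiantsHypothesis.ValiantsHypothesis.Theorems.TwoProducts.RankTwoJacobian

open scoped BigOperators Pointwise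
open MvPolynomial

section TowerKernel
open scoped Classical

/-! ### Stage C: polynomial-level notions, the exceptional set of `w₁`, specials -/

/-- `IsEdgeDir` is a tie in the support (definitional). [folklore] -/
theorem isEdgeDir_iff_tie (ν : Fin 2 → ℝ) (F : Poly2) : IsEdgeDir ν F ↔ TieIn ν F.support := Iff.rfl

/-- A special direction is a tie. [folklore] -/
theorem special_tie {ν : Fin 2 → ℝ} {F : Poly2} {e : Expo} (h : IsSpecial ν F e) : TieIn ν F.support := by
  obtain ⟨p, hp, q, hq, hpq, hmax, hqp, -, -⟩ := h
  exact ⟨p, hp, q, hq, hpq, hmax, hqp⟩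

/-- In a special direction one of the two top points lies on the axis. [folklore] -/
theorem special_axis_top {ν : Fin 2 → ℝ} {F : Poly2} {e : Expo} (h : IsSpecial ν F e) :
    ∃ a ∈ F.support, OnAxis a e ∧ ∀ r ∈ F.support, wt ν r ≤ wt ν a := by
  obtain ⟨p, hp, q, hq, _, hmax, hqp, -, hax⟩ := h
  rcases hax with ha | ha
  · exact ⟨p, hp, ha, hmax⟩
  · exact ⟨q, hq, ha, fun r hr => hqp ▸ hmax r hr⟩

/-- the non-zero exponents of `w` -/
def S1 (w : Poly2) : Finset Expo := w.support.filter (fun s => s ≠ 0)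

/-- Membership in the non-constant support `S1`. [folklore] -/
theorem mem_S1 {w : Poly2} {s : Expo} : s ∈ S1 w ↔ s ∈ w.support ∧ s ≠ 0 := Finset.mem_filter

/-- the EXCEPTIONAL chart values of `w`: pair crossings of non-zero exponents and axis-orthogonality values
(crude version of memo Lemma 1: `≤ t² + t` values instead of `≤ 4t − 1` directions). -/
def Xc (σ : ℝ) (w : Poly2) : Finset ℝ :=
  (((S1 w) ×ˢ (S1 w)).filter (fun x => x.1 0 ≠ x.2 0)).image (fun x => cross σ x.1 x.2) ∪
  ((S1 w).filter (fun e => e 0 ≠ 0)).image (fun e => -σ * ((e 1 : ℕ) : ℝ) / ((e 0 : ℕ) : ℝ))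

/-- The candidate exceptional set `Xc` has `≤ |S1|² + |S1|` elements. [folklore] -/
theorem card_Xc_le (σ : ℝ) (w : Poly2) :
    (Xc σ w).card ≤ w.support.card * w.support.card + w.support.card := by
  have hS : (S1 w).card ≤ w.support.card := Finset.card_filter_le _ _
  unfold Xc
  refine (Finset.card_union_le _ _).trans ?_
  refine add_le_add ?_ ?_
  · refine Finset.card_image_le.trans ((Finset.card_filter_le _ _).trans ?_)
    rw [Finset.card_product]
    exact Nat.mul_le_mul hS hS
  · exact Finset.card_image_le.trans ((Finset.card_filter_le _ _).trans hS)

/-- A tie direction of `S1 w` lies in `Xc`. [folklore] -/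
theorem tie_mem_Xc {σ : ℝ} (hσ : σ = 1 ∨ σ = -1) {w : Poly2} {μ : ℝ} (h : TieIn (dir σ μ) (S1 w)) :
    μ ∈ Xc σ w := by
  obtain ⟨p, hp, q, hq, hpq, -, hqp⟩ := h
  have h0 : q 0 ≠ p 0 := fun h0 => hpq (eq_of_wt_eq hσ h0 hqp).symm
  have hμ : μ = cross σ q p := wt_eq_imp_cross h0 hqp
  unfold Xc
  apply Finset.mem_union_left
  rw [Finset.mem_image]
  exact ⟨(q, p), Finset.mem_filter.mpr ⟨Finset.mem_product.mpr ⟨hq, hp⟩, h0⟩, hμ.symm⟩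

/-- An axis direction of a letter of `S1 w` lies in `Xc`. [folklore] -/
theorem axis_mem_Xc {σ : ℝ} {w : Poly2} {e : Expo} (he : e ∈ S1 w) (he0 : e 0 ≠ 0) :
    -σ * ((e 1 : ℕ) : ℝ) / ((e 0 : ℕ) : ℝ) ∈ Xc σ w := by
  unfold Xc
  apply Finset.mem_union_right
  rw [Finset.mem_image]
  exact ⟨e, Finset.mem_filter.mpr ⟨he, he0⟩, rfl⟩

/-- Weight factorisation along the axis of `e`. [folklore] -/
theorem wt_lead_factor (σ x : ℝ) {e : Expo} (he0 : e 0 ≠ 0) :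
    wt (dir σ x) e = ((e 0 : ℕ) : ℝ) * (x - (-σ * ((e 1 : ℕ) : ℝ) / ((e 0 : ℕ) : ℝ))) := by
  have h : ((e 0 : ℕ) : ℝ) ≠ 0 := by exact_mod_cast he0
  rw [wt_dir]
  field_simp
  ring

/-- memo Lemma 1 (existence half): outside the exceptional values, `w` has an axial lead -/
theorem axialLead_of_not_mem {σ : ℝ} (hσ : σ = 1 ∨ σ = -1) {w : Poly2} (hS : (S1 w).Nonempty)
    {l : ℝ} (hl : l ∉ Xc σ w) : ∃ e, IsAxialLead (dir σ l) w e := by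
  obtain ⟨e, heS, hmax⟩ := Finset.exists_max_image (S1 w) (wt (dir σ l)) hS
  obtain ⟨hew, he0⟩ := mem_S1.mp heS
  refine ⟨e, hew, he0, ?_, ?_⟩
  · intro hw0
    by_cases h0 : e 0 = 0
    · -- then σ e1 = 0, so e = 0
      rw [wt_dir, h0] at hw0
      have : ((e 1 : ℕ) : ℝ) = 0 := by
        have h1 : σ * ((e 1 : ℕ) : ℝ) = 0 := by simpa using hw0
        rcases mul_eq_zero.mp h1 with h | h
        · exact absurd h (sigma_ne_zero hσ)
        · exact h
      have h1 : e 1 = 0 := by exact_mod_cast this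
      exact he0 (expo_eq_of_coords (by simpa using h0) (by simpa using h1))
    · apply hl
      have hf := wt_lead_factor σ l h0
      rw [hw0] at hf
      have h0r : ((e 0 : ℕ) : ℝ) ≠ 0 := by exact_mod_cast h0
      have : l = -σ * ((e 1 : ℕ) : ℝ) / ((e 0 : ℕ) : ℝ) := by
        rcases mul_eq_zero.mp hf.symm with h | h
        · exact absurd h h0r
        · linarith
      rw [this]; exact axis_mem_Xc heS h0
  · intro s hs hs0 hse
    have hsS : s ∈ S1 w := mem_S1.mpr ⟨hs, hs0⟩
    rcases (hmax s hsS).lt_or_eq with h | h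
    · exact h
    · exfalso
      by_cases h0 : s 0 = e 0
      · exact hse (eq_of_wt_eq hσ h0 h)
      · exact hl (wt_eq_imp_cross h0 h ▸ (by
          unfold Xc; apply Finset.mem_union_left; rw [Finset.mem_image]
          exact ⟨(s, e), Finset.mem_filter.mpr ⟨Finset.mem_product.mpr ⟨hsS, heS⟩, h0⟩, rfl⟩))

/-- An axial lead is a unique top of `S1 w`. [folklore] -/
theorem lead_utop {ν : Fin 2 → ℝ} {w : Poly2} {e : Expo} (h : IsAxialLead ν w e) : IsUTop ν (S1 w) e := by
  obtain ⟨hew, he0, -, hdom⟩ := h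
  exact ⟨mem_S1.mpr ⟨hew, he0⟩, fun r hr hre => hdom r (mem_S1.mp hr).1 (mem_S1.mp hr).2 hre⟩

/-- chart edge values of `F` (a superset of the tie values) and the tie set itself -/
def EV (σ : ℝ) (F : Poly2) : Finset ℝ :=
  ((F.support ×ˢ F.support).filter (fun x => x.1 0 ≠ x.2 0)).image (fun x => cross σ x.1 x.2)

/-- A tie direction of `F` lies in `EV σ F`. [folklore] -/
theorem mem_EV_of_tie {σ : ℝ} (hσ : σ = 1 ∨ σ = -1) {F : Poly2} {μ : ℝ} (h : TieIn (dir σ μ) F.support) :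
    μ ∈ EV σ F := by
  obtain ⟨p, hp, q, hq, hpq, -, hqp⟩ := h
  have h0 : q 0 ≠ p 0 := fun h0 => hpq (eq_of_wt_eq hσ h0 hqp).symm
  have hμ : μ = cross σ q p := wt_eq_imp_cross h0 hqp
  unfold EV; rw [Finset.mem_image]
  exact ⟨(q, p), Finset.mem_filter.mpr ⟨Finset.mem_product.mpr ⟨hq, hp⟩, h0⟩, hμ.symm⟩

/-- `|EV σ F| ≤ |supp F|²`. [folklore] -/
theorem card_EV_le (σ : ℝ) (F : Poly2) : (EV σ F).card ≤ F.support.card * F.support.card := by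
  unfold EV
  refine Finset.card_image_le.trans ((Finset.card_filter_le _ _).trans ?_)
  rw [Finset.card_product]

/-- The EXCEPTIONAL SET of `F` in the chart `σ`: the tie directions (edge directions of `Newt F`). [val-idea-35 g9] -/
def Eset (σ : ℝ) (F : Poly2) : Finset ℝ := (EV σ F).filter (fun μ => TieIn (dir σ μ) F.support)

/-- Membership in the exceptional set = a tie. [folklore] -/
theorem mem_Eset {σ : ℝ} (hσ : σ = 1 ∨ σ = -1) {F : Poly2} {μ : ℝ} :
    μ ∈ Eset σ F ↔ IsEdgeDir (dir σ μ) F := by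
  unfold Eset; rw [Finset.mem_filter, isEdgeDir_iff_tie]
  exact ⟨fun h => h.2, fun h => ⟨mem_EV_of_tie hσ h, h⟩⟩

/-- `|Eset σ F| ≤ |supp F|²`. [folklore] -/
theorem card_Eset_le (σ : ℝ) (F : Poly2) : (Eset σ F).card ≤ F.support.card * F.support.card :=
  (Finset.card_filter_le _ _).trans (card_EV_le σ F)

/-- The zero polynomial has no exceptional directions. [folklore] -/
theorem Eset_zero (σ : ℝ) : Eset σ (0 : Poly2) = ∅ := by
  unfold Eset EV; simp


end TowerKernel

end Summit.ValiantsHypothesis.ValiantsHypothesis.Theorems.TwoProducts.RankTwoJacobian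

end
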